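import Mathlib.Analysis.SpecialFunctions.Integrals.Basic
import Mathlib.MeasureTheory.Integral.Bochner.Set
import Mathlib.MeasureTheory.Function.LocallyIntegrable
import HarnessLib

/-!
# Nikolskii's inequality for non-negative trigonometric polynomials

Elementary Fourier facts about a trigonometric polynomial of degree `≤ D` written in exponential form,
`g(t) = ∑_{k=-D}^{D} a_k e^{ikt}` (`g : ℝ → ℂ`, or a real `f` with `↑(f t) = ∑ …`):

* `integral_cexp_int_mul_Icc` — orthogonality `∫_{[-π,π]} e^{int} dt = 2π δ_{n,0}`;
* `trigPoly_coeff_eq` — the coefficient formula `a_m = (1/2π) ∫_{[-π,π]} g(t) e^{-imt} dt`, `|m| ≤ D`;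
* `norm_trigPoly_coeff_le_mean` — for `f ≥ 0`: `‖a_m‖ ≤ ⨍ f := (∫_{[-π,π]} f) / (2π)`;
* `trigPoly_nikolskii` — **Nikolskii's inequality** for NON-NEGATIVE trigonometric polynomials:
  `f(t) ≤ (2D+1) ⨍ f` for all `t` (proof: `f = |∑ a_k e^{ikt}| ≤ ∑ |a_k| ≤ (2D+1) ⨍ f`).

This is the `p = 1, q = ∞` case of the Nikolskii inequality between different metrics for
trigonometric polynomials (S. M. Nikolskii 1951; see P. Borwein, T. Erdélyi, *Polynomials and Polynomial
Inequalities*, GTM 161, §5.1 and §6.1), in the special form available for `f ≥ 0`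
where `‖f‖₁ = 2π ⨍ f` and the constant `2D+1` (the value of the Dirichlet kernel at `0`) is sharp
(Fejér kernel). Everything is proved; no definitions, no named facts. Continuity, periodicity and
the Remez-type small-ball estimate for such `f` are in `Literature/Analysis/Fourier/TrigPolySmallBall.lean`.
-/

noncomputable section

open scoped Real
open MeasureTheory Set Complex

namespace Literature.Analysis.Fourier

/-- **Orthogonality of the characters on the circle**: for `n : ℤ`,
`∫_{[-π,π]} e^{int} dt = 2π` if `n = 0` and `= 0` otherwise. [folklore] -/
theorem integral_cexp_int_mul_Icc (n : ℤ) :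
    ∫ t in Icc (-π) π, cexp ((n : ℂ) * (t : ℂ) * I) = if n = 0 then 2 * (π : ℂ) else 0 := by
  rw [integral_Icc_eq_integral_Ioc,
    ← intervalIntegral.integral_of_le (by linarith [Real.pi_pos] : -π ≤ π)]
  split_ifs with hn
  · subst hn
    simp only [Int.cast_zero, zero_mul, Complex.exp_zero, intervalIntegral.integral_const,
      Complex.real_smul, mul_one]
    push_cast
    ring
  · have hc : (n : ℂ) * I ≠ 0 := mul_ne_zero (by exact_mod_cast hn) I_ne_zero
    have h1 : (fun t : ℝ => cexp ((n : ℂ) * (t : ℂ) * I)) = fun t : ℝ => cexp ((n : ℂ) * I * t) := by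
      funext t
      ring_nf
    rw [h1, integral_exp_mul_complex hc]
    have h2 : cexp ((n : ℂ) * I * (π : ℝ)) = cexp ((n : ℂ) * I * (-π : ℝ)) := by
      rw [show (n : ℂ) * I * ((π : ℝ) : ℂ) = (n : ℂ) * I * ((-π : ℝ) : ℂ) + n * (2 * π * I) by
        push_cast; ring, Complex.exp_add, Complex.exp_int_mul_two_pi_mul_I, mul_one]
    rw [h2, sub_self, zero_div]

/-- **Fourier coefficient formula** for a trigonometric polynomial `g(t) = ∑_{|k| ≤ D} a_k e^{ikt}`:
`a_m = (1/2π) ∫_{[-π,π]} g(t) e^{-imt} dt` for `|m| ≤ D` (multiply, integrate term by term, use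
orthogonality). [folklore] -/
theorem trigPoly_coeff_eq {D : ℕ} {a : ℤ → ℂ} {g : ℝ → ℂ}
    (hg : ∀ t : ℝ, g t = ∑ k ∈ Finset.Icc (-(D : ℤ)) D, a k * cexp ((k : ℂ) * (t : ℂ) * I))
    {m : ℤ} (hm : m ∈ Finset.Icc (-(D : ℤ)) D) :
    a m = 1 / (2 * π) * ∫ t in Icc (-π) π, g t * cexp (-((m : ℂ) * (t : ℂ) * I)) := by
  have h1 : ∀ t : ℝ, g t * cexp (-((m : ℂ) * (t : ℂ) * I)) =
      ∑ k ∈ Finset.Icc (-(D : ℤ)) D, a k * cexp (((k - m : ℤ) : ℂ) * (t : ℂ) * I) := by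
    intro t
    rw [hg t, Finset.sum_mul]
    refine Finset.sum_congr rfl fun k _ => ?_
    rw [mul_assoc, ← Complex.exp_add]
    congr 2
    push_cast
    ring
  simp_rw [h1]
  rw [integral_finsetSum]
  · simp_rw [integral_const_mul, integral_cexp_int_mul_Icc, sub_eq_zero, mul_ite, mul_zero]
    rw [Finset.sum_ite_eq' _ m, if_pos hm]
    have hπ : (π : ℂ) ≠ 0 := by exact_mod_cast Real.pi_ne_zero
    field_simp
  · intro k _
    exact (by fun_prop : Continuous fun t : ℝ =>
      a k * cexp (((k - m : ℤ) : ℂ) * (t : ℂ) * I)).integrableOn_Icc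

/-- For a NON-NEGATIVE real trigonometric polynomial every coefficient is bounded by the mean:
`‖a_m‖ ≤ (1/2π) ∫_{[-π,π]} |f e^{-im·}| = ⨍ f`. [folklore] -/
theorem norm_trigPoly_coeff_le_mean {D : ℕ} {a : ℤ → ℂ} {f : ℝ → ℝ}
    (hf : ∀ t : ℝ, ((f t : ℝ) : ℂ) = ∑ k ∈ Finset.Icc (-(D : ℤ)) D, a k * cexp ((k : ℂ) * (t : ℂ) * I))
    (hpos : ∀ t, 0 ≤ f t) {m : ℤ} (hm : m ∈ Finset.Icc (-(D : ℤ)) D) :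
    ‖a m‖ ≤ (∫ s in Icc (-π) π, f s) / (2 * π) := by
  rw [trigPoly_coeff_eq hf hm, norm_mul]
  have h1 : ‖(1 / (2 * π) : ℂ)‖ = 1 / (2 * π) := by
    rw [show (1 / (2 * π) : ℂ) = ((1 / (2 * π) : ℝ) : ℂ) by push_cast; ring, Complex.norm_real,
      Real.norm_of_nonneg (by positivity)]
  have h2 : ‖∫ t in Icc (-π) π, ((f t : ℝ) : ℂ) * cexp (-((m : ℂ) * (t : ℂ) * I))‖ ≤
      ∫ s in Icc (-π) π, f s := by
    refine (norm_integral_le_integral_norm _).trans_eq ?_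
    congr 1
    funext t
    rw [norm_mul, Complex.norm_real, Real.norm_of_nonneg (hpos t),
      show -((m : ℂ) * (t : ℂ) * I) = ((-(m * t) : ℝ) : ℂ) * I by push_cast; ring,
      Complex.norm_exp_ofReal_mul_I, mul_one]
  rw [h1]
  calc 1 / (2 * π) * ‖∫ t in Icc (-π) π, ((f t : ℝ) : ℂ) * cexp (-((m : ℂ) * (t : ℂ) * I))‖
      ≤ 1 / (2 * π) * ∫ s in Icc (-π) π, f s := by gcongr
    _ = (∫ s in Icc (-π) π, f s) / (2 * π) := by ring

/-- **Nikolskii's inequality for non-negative trigonometric polynomials.** If `f ≥ 0` is a real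
trigonometric polynomial of degree `≤ D`, `↑(f t) = ∑_{k=-D}^{D} a_k e^{ikt}`, then
`f(t) ≤ (2D+1) · (∫_{[-π,π]} f)/(2π)` for every `t` (since `f = |∑ a_k e^{ikt}| ≤ ∑ |a_k|` and each
`|a_k| ≤ ⨍ f`). Nikolskii 1951; Borwein–Erdélyi, GTM 161, §5.1 / §6.1. [folklore] -/
theorem trigPoly_nikolskii :
    ∀ (D : ℕ) (f : ℝ → ℝ),
      (∃ a : ℤ → ℂ, ∀ t : ℝ, ((f t : ℝ) : ℂ) =
        ∑ k ∈ Finset.Icc (-(D : ℤ)) D, a k * Complex.exp ((k : ℂ) * (t : ℂ) * Complex.I)) →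
      (∀ t, 0 ≤ f t) → ∀ t : ℝ, f t ≤ (2 * D + 1) * ((∫ s in Set.Icc (-π) π, f s) / (2 * π)) := by
  rintro D f ⟨a, hf⟩ hpos t
  have h1 : f t = ‖((f t : ℝ) : ℂ)‖ := by rw [Complex.norm_real, Real.norm_of_nonneg (hpos t)]
  have hcard : ((Finset.Icc (-(D : ℤ)) D).card : ℝ) = 2 * D + 1 := by
    rw [Int.card_Icc, show (D : ℤ) + 1 - -(D : ℤ) = ((2 * D + 1 : ℕ) : ℤ) by push_cast; ring,
      Int.toNat_natCast]
    push_cast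
    ring
  calc f t = ‖((f t : ℝ) : ℂ)‖ := h1
    _ = ‖∑ k ∈ Finset.Icc (-(D : ℤ)) D, a k * cexp ((k : ℂ) * (t : ℂ) * I)‖ := by rw [hf t]
    _ ≤ ∑ k ∈ Finset.Icc (-(D : ℤ)) D, ‖a k * cexp ((k : ℂ) * (t : ℂ) * I)‖ := norm_sum_le _ _
    _ = ∑ k ∈ Finset.Icc (-(D : ℤ)) D, ‖a k‖ := by
        refine Finset.sum_congr rfl fun k _ => ?_
        rw [norm_mul, show (k : ℂ) * (t : ℂ) * I = (((k : ℝ) * t : ℝ) : ℂ) * I by push_cast; ring,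
          Complex.norm_exp_ofReal_mul_I, mul_one]
    _ ≤ ∑ _k ∈ Finset.Icc (-(D : ℤ)) D, (∫ s in Icc (-π) π, f s) / (2 * π) :=
        Finset.sum_le_sum fun k hk => norm_trigPoly_coeff_le_mean hf hpos hk
    _ = (2 * D + 1) * ((∫ s in Set.Icc (-π) π, f s) / (2 * π)) := by
        rw [Finset.sum_const, nsmul_eq_mul, hcard]

end Literature.Analysis.Fourier
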